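import Summits.AtomisticToContinuum.BoseEinsteinCondensation.Theses.BECInsertionCorrector
import Summits.AtomisticToContinuum.BoseEinsteinCondensation.Theorems.CorrectorClosure.Negative.InsertionResidueLoadBearing
import Summits.AtomisticToContinuum.BoseEinsteinCondensation.Theorems.CorrectorClosure.Negative.InsertionResidueUniformWindowFalse
import Summits.AtomisticToContinuum.BoseEinsteinCondensation.Theorems.CorrectorClosure.Negative.InsertionResidueConstantTight
import Summits.AtomisticToContinuum.BoseEinsteinCondensation.Theorems.CorrectorClosure.Negative.InsertionResidueHardCoreJamming
import Literature.MathematicalPhysics.QuantumManyBody.PeriodicHeatFlowSpectral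
import HarnessLib.Audit

/-!
# Line `residue-area-law` — skeleton for crux `BECInsertionCorrector.CorrectorClosure`
(item stmt-AtomisticToContinuum-12058, route route-AtomisticToContinuum-BECInsertionCorrector;
crux-plan seat planner-cruxplan-stmt-AtomisticToContinuum-12058-residue-area-law-0, 2026-08-16)

Crux (fixed, by name): `CorrectorClosure := StaticResponseBound → InsertionResidue`.

## Idea (card `Cruxes/CorrectorClosure/Ideas/residue-area-law.md`, triage r1-1/2/3: pass ×3)

The insertion residue is read off ONE scalar function of imaginary time, the **flat insertion
partition function** of the bath ground state `Θ₀` (the `N`-body periodic Feynman–Kac ground state,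
`IsPeriodicGroundStateFK v L Θ₀`, `L = sideLength ρ (N+1)`):

  `𝒵(t) = ∫_{cell^{N+1}} ψ₀ · (e^{-tH_{N+1}} ψ₀)`,  `ψ₀(x₀, X) = Θ₀(X)`  (flat in the added particle),

typed over the tree's torus Feynman–Kac semigroup `periodicFKSemigroup v L t` on `Config (N+1)`
(`ℝ≥0∞`-valued, junk-free: all data are nonnegative). `𝒵` is the Laplace transform of the spectral
measure of `ψ₀`; the DOUBLING FIDELITY `1/D(t) = 𝒵(t)²/(𝒵(2t)𝒵(0)) = cos²∠(ψ₀, e^{-tH}ψ₀) ∈ (0,1]` is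
non-increasing (log-convexity) and converges, as `t → ∞`, to the spectral weight of `ψ₀` at the
bottom of its support — by Perron–Frobenius the bosonic ground state — i.e. to the insertion residue
`Z_N = |⟨φ₀ ⊗ Θ₀, Ψ_{N+1}⟩|²`. Hence the exact DYADIC LEDGER (the card's area law in doubling form)

  `log(1/Z_N) = log D(t₀) + Σ_{m ≥ 0} [log D(2^{m+1} t₀) − log D(2^m t₀)]`,
  `log D(2T) − log D(T) = log 𝒵(4T) − 3 log 𝒵(2T) + 2 log 𝒵(T) ≥ 0`,

in which the reference energy `E₀(N)` and the normalisation of `ψ₀` CANCEL (third differences of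
`log 𝒵` kill affine terms), every term is a FINITE-imaginary-time functional of the flat state (the
scale-`m` term sees the flow only up to time `2^{m+2} t₀`), and no logarithm / exponential moment of
the amplitude `h = Ψ_{N+1}/Ψ_N` is ever taken. `Z_N ≥ c` uniformly in `N` ⇔ the ledger has an
`N`-uniform summable majorant.

## Stubs (4, registered; `sorry` only here) and what each carries

* `stub_shortTime` (M–L): `𝒵` is finite and non-vanishing at all times and the FIRST fidelity drop is
  bounded, `D(t₀) ≤ e^{C₀}` for some `t₀(v,ρ) > 0`, uniformly in `N` — Jensen on the spectral measure +
  the product-state energy identity (soft `v`: `log D(t₀) ≤ 2t₀ρ∫v`); first-moment Wiener-sausage /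
  Lyons–Zheng displacement bound for hard cores and non-integrable cores (`t₀ ≍ R₀²`). This is where
  failure mode 3 of the crux (hard cores, Born `= ∞`) is discharged.
* `stub_dyadicTail` (XL, HARDEST, consumes K1 BY NAME): the ledger increments have an `N`-uniform
  summable majorant `b`: `𝒵(4T)𝒵(T)² ≤ e^{b_m} 𝒵(2T)³`, `T = 2^m t₀`. At second order (Gaussian
  time-cumulant) this is PROVED ON PAPER by the triage panel from K1 alone: the increment is
  `≤ 4T ∫_T^{4T} C(τ)dτ` with `C(τ) = L⁻³Σ_k |v̂_k|² e^{-k²τ} ρ' S_N(k,τ)` (recoil = free heat kernel of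
  the tagged coordinate), `T∫_T^{4T} S_N(k,τ)dτ ≤ c₀ m₋₁(k)` ("Landau on average") and K1's
  `m₋₁(k) ≤ C/max(ρa,k²)` give `b_m ≍ √(ρa³)·min(2^m t₀/ξ², (ξ²/2^m t₀)^{1/2})` (ε = ½, sum `O(√(ρa³))`
  `= ‖χ₁‖²`); the content beyond second order (sign-indefinite third time-cumulants = the route's `χ₂`
  falsifier in time clothing) is THE open infrared problem. Dimension test (Disproof §13): in `d = 1`
  the same majorant is `≍ T^{1/2}`, not summable — the stub is where the line uses `d = 3`.
* `stub_groundStateExists` (L): at low density and for all large `N` the `N`-body bath on the torus of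
  side `sideLength ρ (N+1)` HAS a Feynman–Kac ground state (`IsPeriodicGroundStateFK`: nonnegative
  normalised periodic symmetric eigenfunction of the FK semigroup at the variational energy, with the
  rank-one projection = uniqueness + gap at FIXED `N`). Bounded `v^per`: the named fact
  `PeriodicGroundStateFeynmanKac`; hard / singular cores: Perron–Frobenius on the dilute free region
  (the all-free component carries the bottom of the spectrum) + `E₀^per < ⊤` (finite range, Ruelle).
* `stub_nearMinimiserFrame` (L): the fixed-`N` transfer to the crux's `∃δ ∃Θ ∀Ψ` frame: for every
  `ε > 0` there are `T₁(N, Θ₀, ε)` and a window `δ(N, ε) > 0` (chosen AFTER `N`) such that for all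
  `δ`-near-minimisers `Θ` (N bodies) and `Ψ` (N+1 bodies) and all `t ≥ T₁`:
  `1/D(t) ≤ Res(Θ, Ψ) + ε`, `Res` = verbatim the quantity of `InsertionResidue`. Inputs: the spectral
  representation of `𝒵` (`PeriodicHeatFlowSpectralMeasure`, PROVED in the tree for bounded `v^per`),
  `1/D(t) ↓ m = |⟨ψ̂₀, Ψ_gs⟩|²` at rate `e^{-t·gap}`, bosonic = absolute ground state of `H_{N+1}`
  (PF; `ψ₀ ≥ 0` charges it), and `L²`-rigidity of near-minimisers below the finite-volume gaps.

## Composition (sorry-free): `CorrectorClosure_of`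

`ρ₀ = min ρᵢ`; `t₀, C₀` from `stub_shortTime`; the majorant `b` from `stub_dyadicTail` (fed K1);
`K = C₀ + Σ b`, `c = e^{-K}/2`. Eventually in `N`: `Θ₀` from `stub_groundStateExists`; the ledger is
telescoped by induction on `M` in `ℝ≥0∞` (`ledger_step`, cancelling the finite non-zero factors
supplied by `stub_shortTime`): `𝒵(2^{M+1}t₀)𝒵(0) ≤ e^{C₀ + Σ_{m<M} b_m} 𝒵(2^M t₀)²`; the frame at
`ε = c` and `t = 2^M t₀ ≥ T₁` gives `𝒵(2^M t₀)² ≤ (Res + c)·𝒵(2^{M+1}t₀)𝒵(0)`; cancelling `𝒵(2^M t₀)²`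
yields `e^{-K} ≤ Res + c`, i.e. `Res ≥ c`. `Θ` is any `δ`-near-minimiser (exists: `E₀^per(N) < ⊤` is
a field of `IsPeriodicGroundStateFK`).

## Disproof.lean (gen 3, `Cruxes/CorrectorClosure/Disproof.lean`) and landed Negative lemmas — obligations

* §1 `not_correctorClosure_iff`: K1 is CONSUMED, by name, in `stub_dyadicTail` (the `m₋₁/T` step at
  every dyadic scale) and nowhere else; the other three stubs are K1-free fixed-`N` / short-time facts.
* §3 `insertionResidue_false_without_window` (landed `Negative.InsertionResidueLoadBearing`, imported):
  the window on `Ψ` is used in `stub_nearMinimiserFrame` (rigidity `‖Ψ − ωΨ_gs‖² ≲ δ/gap`) only.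
* §4 `insertionResidue_false_without_finiteRange`: `E₀^per < ⊤` enters through the field
  `IsPeriodicGroundStateFK.energy_ne_top` (existence, `stub_groundStateExists`) and the glue's choice of
  `Θ`; for `v ≡ 1` no FK ground state exists and stubs 1, 2, 4 are vacuous, stub 3 false — as it must be.
* §7 `insertionResidue_false_uniformWindow`: `δ` is produced AFTER `N` (inside `∀ᶠ N`, by
  `stub_nearMinimiserFrame`, below the finite-volume gaps).
* §5/§8 (`Negative.InsertionResidueConstantTight`): `c = e^{-K}/2 < 1`; free gas: `𝒵 ≡ 𝒵(0)`, `D ≡ 1`,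
  every stub holds with `C₀ = 0`, `b = 0` (consistent with `Z = 1`).
* §10 (diluteness load-bearing): every stub carries its own `∃ ρᵢ > 0, ∀ ρ < ρᵢ`.
* §12 (targets of the picked line `llp-fidelity-arc`): not this line's stubs; the shared hidden input
  "uniqueness of the ground ray at fixed `N`" is EXPLICIT here (`stub_groundStateExists` +
  `stub_nearMinimiserFrame`), not silent.
* §13 (dimension test): passed inside `stub_dyadicTail` (see above); stubs 1, 3, 4 are `d`-insensitive
  and carry no infrared weight — as §13 demands.
Negatives index (`ledger negatives`, 12 items): no statement on flat partition functions / doubling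
quotients / FK ground states among them.
-/

noncomputable section

open MeasureTheory Filter
open scoped ENNReal NNReal ComplexConjugate BigOperators

namespace Summit.AtomisticToContinuum.BoseEinsteinCondensation.Cruxes.CorrectorClosure.ResidueAreaLaw

open Literature.MathematicalPhysics.QuantumManyBody.BoseGas
open Summit.AtomisticToContinuum.BoseEinsteinCondensation.Theses.BECInsertionCorrector
open Summit.AtomisticToContinuum.BoseEinsteinCondensation.Theorems.CorrectorClosure.Negative
  (sideLength_succ_pos)

/-! ## Conventions of the signatures

All four stubs quantify, inside `∀ᶠ N`, over EQUATIONAL BINDERS (instantiated with `rfl` in the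
composition): `L = sideLength ρ (N + 1)` (the torus of the `(N+1)`-body problem), `Θ₀ : Config N → ℝ`
with `IsPeriodicGroundStateFK v L Θ₀` (the bath ground state in Feynman–Kac form), and
`Z = fun t => ∫⁻ X in cellN (N+1) L, ψ₀ X * periodicFKSemigroup v L t ψ₀ X` with the flat data
`ψ₀ X = ENNReal.ofReal (Θ₀ (Matrix.vecTail X))` (particle `0` = the inserted one, as in
`InsertionResidue`'s `Matrix.vecCons x X`). So `Z t = 𝒵(t) = ⟨ψ₀, e^{-tH_{N+1}} ψ₀⟩_cell ∈ [0, ∞]`,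
`Z 0 = L³` (un-normalised flat state), and the doubling quotient is `D(t) = Z(2t)·Z(0)/Z(t)²`; every
statement below is written multiplicatively (division-free). -/

/-! ## Stubs (the four open lemmas of the line; `sorry` only here) -/

/-- **Stub 1 — short time: `𝒵` is finite, non-vanishing, and its first fidelity drop is bounded
(size M–L).** For every repulsive finite-range `v` there is `ρ₁ > 0` such that for `0 < ρ < ρ₁` there
are a time `t₀ > 0` and a constant `C₀` with, for all large `N` and the bath FK ground state `Θ₀`:
`𝒵(t) ∈ (0, ∞)` for all `t ≥ 0`, and `D(t₀) = 𝒵(2t₀)𝒵(0)/𝒵(t₀)² ≤ e^{C₀}`.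
Why true: `𝒵(t) ≤ 𝒵(0) = L³ < ∞` (Fubini on `cell × cell^N`, `∫_cell^N Θ₀² = 1`, `L²`-contraction of
the flow); `𝒵(t) > 0` (positive probability that the `N+1` world-lines stay in small disjoint balls,
on which the FK weight is positive — for hard cores the bath ground state vanishes on overlapping
configurations and the flat particle starts outside all cores with positive probability);
`D(t₀) ≤ e^{C₀}`: ground-state-transform the bath (`Θ₀` is an eigenfunction, field `eigen`; the
`(N+1)`-particle Wiener measure factorises bath ⊗ added particle), so that
`Z̃(t) := 𝒵(t)e^{tE₀(N)}/L³ = E[exp(-∫₀ᵗ W(y_s, X_s) ds)]` under (stationary bath diffusion) ⊗ (uniform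
start + Brownian motion of the added particle), `W = Σ_j v^per(y − x_j) ≥ 0`; then `Z̃(2t₀) ≤ 1 = Z̃(0)`
trivially and `D(t₀) = Z̃(2t₀)Z̃(0)/Z̃(t₀)² ≤ E[exp(-∫₀^{t₀} W)]^{-2}` (no spectral input); soft
integrable `v`: Jensen + stationarity, `log D(t₀) ≤ 2t₀ E W = 2t₀ ρ' ∫_{ℝ³} v ≤ 2t₀ρ∫v`; hard /
singular cores: `E[e^{-∫W}] ≥ P(no encounter up to t₀) ≥ 1 − E #{j : bath path j meets the R₀-tube of
the added path} ≥ 1/2` at `ρ < ρ₁(t₀, R₀)` — the added particle starts uniformly and independently of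
the bath, so shell by shell `E # ≤ ρ' Σ_k |B(R₀ + 2λ_{k+1})|·[P(sup_{s≤t₀}|y_s − y₀| > λ_k) +
P(sup_{s≤t₀}|x_j(s) − x_j(0)| > λ_k)]`, with GAUSSIAN displacement tails of the stationary reversible
bath diffusion from the Lyons–Zheng forward/backward martingale decomposition (no drift bound needed),
uniformly in `N`. Degenerate cases: `v = 0` gives `𝒵 ≡ L³`, `C₀ = 0`. Size: M for bounded `v`
(Jensen), L for hard cores (the displacement tail). Leans on: `periodicFKSemigroup`,
`periodicFKPathMeasure`, `periodicFKSemigroup_eq_lintegral_periodicFKPathMeasure`,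
`setLIntegral_cellN_periodicFKSemigroup_le`, `periodicFKWeight_add_eq_mul`,
`IsPeriodicGroundStateFK.eigen/.norm_eq`, `setLIntegral_cellN_succ_left` (tree);
`MeasureTheory.lintegral_prod` (Mathlib).
[cite: KipnisLandim1999, App. 1 §6 (6.1) (Feynman–Kac exponential bounds); FukushimaOshimaTakeda2011, §5.7 (Lyons–Zheng forward/backward martingale decomposition)] -/
theorem stub_shortTime :
    ∀ (v : ℝ → ℝ≥0∞), IsRepulsiveFiniteRange v → ∃ ρ₁ : ℝ, 0 < ρ₁ ∧ ∀ ρ : ℝ, 0 < ρ → ρ < ρ₁ →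
      ∃ t₀ : ℝ, 0 < t₀ ∧ ∃ C₀ : ℝ, ∀ᶠ N : ℕ in atTop, ∀ (L : ℝ), L = sideLength ρ (N + 1) →
        ∀ (Θ₀ : Config N → ℝ), IsPeriodicGroundStateFK v L Θ₀ → ∀ (Z : ℝ → ℝ≥0∞),
          (Z = fun t => ∫⁻ X in cellN (N + 1) L, ENNReal.ofReal (Θ₀ (Matrix.vecTail X)) *
              periodicFKSemigroup v L t (fun Y => ENNReal.ofReal (Θ₀ (Matrix.vecTail Y))) X) →
          (∀ t : ℝ, 0 ≤ t → Z t ≠ 0 ∧ Z t ≠ ⊤) ∧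
          Z (2 * t₀) * Z 0 ≤ ENNReal.ofReal (Real.exp C₀) * Z t₀ ^ 2 := by
  sorry

/-- **Stub 2 — the dyadic tail (size XL, HARDEST; the Transfer target `C⁺ = SummableDoublingDefects`;
K1 consumed HERE, by name).** Given `StaticResponseBound`, for every repulsive finite-range `v` there
is `ρ₂ > 0` such that for `0 < ρ < ρ₂` and EVERY base time `t₀ > 0` there is a nonnegative summable
majorant `b : ℕ → ℝ` with, for all large `N`, the bath FK ground state `Θ₀` and every scale `m`
(`T = 2^m t₀`): `𝒵(4T)·𝒵(T)² ≤ e^{b m}·𝒵(2T)³`, i.e. `log D(2T) − log D(T) ≤ b_m` uniformly in `N`.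
Why plausibly true: the increment is a third difference of the log-Laplace transform of a positive
measure, `≥ 0` (log-convexity), and exactly the energy drop of the evolved flat state upon doubling the
evolution time; at second order in `W̃ = W − E W` it is `2∫ k_T(τ)C(τ)dτ ≤ 4T∫_T^{4T}C(τ)dτ`,
`C(τ) = L⁻³ Σ_{k≠0} |v̂(k)|² e^{-k²τ} ρ' S_N(k,τ)` (recoil `e^{-k²τ}` = free torus heat kernel of the
added particle; `S_N(k,τ) = N⁻¹⟨ρ_kΘ₀, e^{-τ(H_N−E₀)}ρ_kΘ₀⟩`, `∫₀^∞ S_N dτ = m₋₁(k) =`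
`N⁻¹·hMinusOneSqW L Θ₀ (Σ_j cos k·x_j)`), and `T∫_T^{4T} S_N(k,τ)dτ ≤ c₀ m₋₁(k)` with K1's
`m₋₁(k) ≤ C/max(ρ'a, k²)` (via the route's support `StaticResponseToHMinusOne`, stmt-12060, at the bath
density `ρ' = ρN/(N+1)`) gives the N-UNIFORM profile
`b_m ≍ √(ρa³)·min(2^m t₀/ξ², (ξ²/(2^m t₀))^{1/2})`, `ξ² = 1/(8πρa)` (triage r1-1/r1-3 computations;
dyadic sum `O(√(ρa³)) = ‖χ₁‖²`, the route's first corrector); UV end for hard cores: `≍ ρR₀²√T`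
(Wiener sausage), summable as `T ↓`. The OPEN content is the all-orders statement: the third and higher
time-cumulants of `∫W̃` along (stationary bath diffusion ⊗ Brownian motion), i.e. truncated multi-time
density correlations of the ground-state process with recoil kernels between the times — the route's
two-mode / `χ₂` difficulty in time clothing (route CHEAPEST FALSIFIER = this stub's falsifier: a
`log L` in the third cumulant's boundary term kills the `N`-uniform majorant). K1's global form (all
couplings `t`: `⟨G_k⟩_Ψ² ≤ 4C n(k) ⟨Ψ,(H−E₀)Ψ⟩` for every state `Ψ`) is available here beyond linear
response. Why it might fail: an `N`-dependent slow scale `T(N) → ∞` carrying `O(1)` ledger mass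
(uniform summability is STRONGER than `Z_N ≥ c`). Dimension test: in `d = 1` the second-order majorant
is `≍ T^{1/2}` — the stub is false there, as Disproof §13 requires of the load-bearing step.
Leans on: `StaticResponseBound` (hypothesis), `StaticResponseToHMinusOne` (route support 12060),
`hMinusOneSqW`, `IsPeriodicGroundStateFK.eigen`, `periodicFKWeight_add_eq_mul` /
`periodicHeatFlow_semigroup` (Markov property), `periodicFKSemigroup_comp_perm`,
`periodicHeatFlow_add_const` (translation covariance), `cellFourierCoeff` / `tsum_sq_cellFourierCoeff`
(Parseval on the cell) (tree).
[cite: KipnisVaradhan1986, Thm 1.8 (variance `2∫₀^∞⟨T_tV,V⟩dt`); KipnisLandim1999, App. 1 §6; LorincziMinlosSpohn2002, Thm 1.1 and §4 (infrared regularity of a particle coupled to a massless field via Gibbs measures on path space); GuentherEtAl2021, eqs. (3),(10)] -/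
theorem stub_dyadicTail :
    StaticResponseBound → ∀ (v : ℝ → ℝ≥0∞), IsRepulsiveFiniteRange v →
      ∃ ρ₂ : ℝ, 0 < ρ₂ ∧ ∀ ρ : ℝ, 0 < ρ → ρ < ρ₂ → ∀ t₀ : ℝ, 0 < t₀ →
        ∃ b : ℕ → ℝ, Summable b ∧ (∀ m, 0 ≤ b m) ∧
          ∀ᶠ N : ℕ in atTop, ∀ (L : ℝ), L = sideLength ρ (N + 1) →
            ∀ (Θ₀ : Config N → ℝ), IsPeriodicGroundStateFK v L Θ₀ → ∀ (Z : ℝ → ℝ≥0∞),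
              (Z = fun t => ∫⁻ X in cellN (N + 1) L, ENNReal.ofReal (Θ₀ (Matrix.vecTail X)) *
                  periodicFKSemigroup v L t (fun Y => ENNReal.ofReal (Θ₀ (Matrix.vecTail Y))) X) →
              ∀ m : ℕ, Z (2 ^ (m + 2) * t₀) * Z (2 ^ m * t₀) ^ 2 ≤
                ENNReal.ofReal (Real.exp (b m)) * Z (2 ^ (m + 1) * t₀) ^ 3 := by
  sorry

/-- **Stub 3 — the bath has a Feynman–Kac ground state at low density (size L).** For every repulsive
finite-range `v` there is `ρ₃ > 0` such that for `0 < ρ < ρ₃` and all large `N`, the `N`-body periodic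
Hamiltonian on the torus of side `sideLength ρ (N+1)` (the box of the `(N+1)`-body problem; bath density
`ρN/(N+1) < ρ`) admits a witness of `IsPeriodicGroundStateFK`: a nonnegative, cell-normalised, periodic,
Bose-symmetric pointwise eigenfunction of the FK semigroup at the variational energy
`periodicGroundStateEnergy v N L < ⊤`, with the rank-one ground-state projection (nondegeneracy + gap
at FIXED `N, L`). Why true: bounded `v` (hence bounded `v^per` once `L > 2R₀`): verbatim the named
fact `PeriodicGroundStateFeynmanKac` (Chung–Zhao Feynman–Kac semigroup of the flat torus, compact and
positivity improving ⇒ Perron–Frobenius) with `1 ≤ N`; `⊤`-valued / non-integrable cores: the killed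
semigroup on the dilute free region `{min_{i<j} |xᵢ−xⱼ|_𝕋 > R_core}` (compact resolvent: `H¹₀` of a
bounded open set), positivity improving on the all-free connected component, which carries the bottom
of the spectrum by an `O(R_core⁻²) ≫ ρa` confinement margin over jammed components (Disproof §12
discussion), and `E₀^per(N, L) < ⊤` eventually from Ruelle finiteness
(`exists_eventually_periodicGroundStateEnergy_lt_top`, with `sideLength (ρN/(N+1)) N = sideLength ρ (N+1)`).
Why it might fail: only for hard cores, through an unexpected degeneracy of the dilute free region's
Dirichlet ground state (excluded physically at `ρR₀³ ≪ 1`). Leans on: `PeriodicGroundStateFeynmanKac`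
(named fact, unproved, bounded case), `IsPeriodicGroundStateFK`, `periodicFKGroundState`,
`exists_eventually_periodicGroundStateEnergy_lt_top` (tree).
[cite: ChungZhao1995, §3.2 (26), Thm 3.10, Props 3.11–3.15; ReedSimonIV1978, Thm XIII.44; GlimmJaffeQP1987, §3.3 Thm 3.3.2] -/
theorem stub_groundStateExists :
    ∀ (v : ℝ → ℝ≥0∞), IsRepulsiveFiniteRange v → ∃ ρ₃ : ℝ, 0 < ρ₃ ∧ ∀ ρ : ℝ, 0 < ρ → ρ < ρ₃ →
      ∀ᶠ N : ℕ in atTop, ∃ Θ₀ : Config N → ℝ, IsPeriodicGroundStateFK v (sideLength ρ (N + 1)) Θ₀ := by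
  sorry

/-- **Stub 4 — the near-minimiser frame: the large-time doubling fidelity sits below the crux's
overlap (size L; fixed-`N` spectral theory, the ONLY place the window on `Ψ` is used).** For every
repulsive finite-range `v` there is `ρ₄ > 0` such that for `0 < ρ < ρ₄`, all large `N` and the bath FK
ground state `Θ₀` on the torus `L = sideLength ρ (N+1)`: for every `ε > 0` there are a time `T₁` and a
window `δ > 0` (both AFTER `N`) such that for every `δ`-near-minimiser `Θ` of the periodic `N`-body
energy, every `δ`-near-minimiser `Ψ` of the periodic `(N+1)`-body energy and every `t ≥ T₁`,
`𝒵(t)² ≤ (Res(Θ,Ψ) + ε)·𝒵(2t)·𝒵(0)`, where `Res(Θ,Ψ) = L⁻³|∫ conj Θ(X) ∫_cell Ψ(x,X) dx dX|²` is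
verbatim the quantity of `InsertionResidue` — i.e. `1/D(t) ≤ Res + ε`.
Why true: by the spectral representation of the torus flow (`PeriodicHeatFlowSpectralMeasure`, PROVED
as `PeriodicHeatFlowSpectralMeasure_holds` for bounded `v^per`; for hard cores from the semigroup law +
symmetry + Hilbert–Schmidt, as its docstring prescribes) `𝒵(t)/𝒵(0) = ∫e^{-tE}dμ(E)` for a probability
measure `μ`; with `m = μ({min supp μ})`, `r(t) = ∫_{E > min} e^{-t(E−min)}dμ ≤ e^{-t·gap}`:
`1/D(t) = (m + r(t))²/(m + r(2t)) ≤ m + 2r(t) + r(t)²/m → m`; `ψ₀ ≥ 0`, `≠ 0` and Perron–Frobenius for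
`H_{N+1}` on bath-symmetric functions (absolute = bosonic ground state `Ψ_gs > 0`, simple, gapped at
fixed `N, L`) give `min supp μ = E₀^per(N+1, L)` and `m = |⟨ψ̂₀, Ψ_gs⟩|² > 0`; finally
`|⟨φ₀⊗Θ, Ψ⟩| ≥ |⟨φ₀⊗Θ₀, Ψ_gs⟩| − ‖Θ − ωΘ₀‖ − ‖Ψ − ω′Ψ_gs‖` with `‖Θ − ωΘ₀‖², ‖Ψ − ω′Ψ_gs‖² ≤ 2δ/gap`
(rigidity of `δ`-near-minimisers below the finite-volume gaps of the `N`- and `(N+1)`-body problems;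
`Θ₀` is THE ground state by the rank-one projection field `tendsto`), so `Res ≥ m − ε/2` once
`δ = δ(N, ε)` is small, and `T₁ = T₁(N, Θ₀, ε)`. `𝒵(t) = 0` makes the inequality trivial. Why it might
fail: not through the mechanism (all fixed-`N`); only if the `(N+1)`-body bosonic ground state on the
torus were degenerate for an admissible `v` at low density (hard-core connectivity, as in Stub 3).
Leans on: `PeriodicHeatFlowSpectralMeasure_holds`, `IsPeriodicGroundStateFK` (+ `.unique`, `.tendsto`),
`periodicHeatFlow_ofReal_eq_periodicFKSemigroup`, `setIntegral_cellN_conj_mul_periodicHeatFlow_comm`,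
`overlap_sq_le_taggedZeroModeOccupation` / `overlap_sq_le_one` (Disproof §5, landed
`Negative.InsertionResidueUniformWindowFalse`), `periodicGroundStateEnergy_le` (tree); Mathlib measure
theory for the Laplace-transform lemma (`MeasureTheory.lintegral`, monotone convergence).
[cite: GlimmJaffeQP1987, §3.3 Thm 3.3.2 and §3.4 (3.4.2); ReedSimonIV1978, Thm XIII.44 and §XIII.12; ReedSimonI1980, Thm VIII.5] -/
theorem stub_nearMinimiserFrame :
    ∀ (v : ℝ → ℝ≥0∞), IsRepulsiveFiniteRange v → ∃ ρ₄ : ℝ, 0 < ρ₄ ∧ ∀ ρ : ℝ, 0 < ρ → ρ < ρ₄ →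
      ∀ᶠ N : ℕ in atTop, ∀ (L : ℝ), L = sideLength ρ (N + 1) →
        ∀ (Θ₀ : Config N → ℝ), IsPeriodicGroundStateFK v L Θ₀ → ∀ (Z : ℝ → ℝ≥0∞),
          (Z = fun t => ∫⁻ X in cellN (N + 1) L, ENNReal.ofReal (Θ₀ (Matrix.vecTail X)) *
              periodicFKSemigroup v L t (fun Y => ENNReal.ofReal (Θ₀ (Matrix.vecTail Y))) X) →
          ∀ ε : ℝ, 0 < ε → ∃ T₁ : ℝ, ∃ δ : ℝ≥0∞, 0 < δ ∧
            ∀ Θ : PeriodicTrialState N L,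
              periodicEnergy v Θ ≤ periodicGroundStateEnergy v N L + δ →
            ∀ Ψ : PeriodicTrialState (N + 1) L,
              periodicEnergy v Ψ ≤ periodicGroundStateEnergy v (N + 1) L + δ →
            ∀ t : ℝ, T₁ ≤ t →
              Z t ^ 2 ≤
                (ENNReal.ofReal ((L ^ 3)⁻¹) *
                    (‖∫ X in cellN N L, conj (Θ.ψ X) *
                        ∫ x in cell L, Ψ.ψ (Matrix.vecCons x X)‖₊ : ℝ≥0∞) ^ 2 +
                  ENNReal.ofReal ε) * (Z (2 * t) * Z 0) := by
  sorry

/-! ## Sorry-free helpers of the composition -/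

/-- One telescoping step of the ledger in `ℝ≥0∞`: from `D(T) ≤ e^S` (as `p·z ≤ e^S·a²`) and the
increment bound `q·a² ≤ e^b·p³` infer `D(2T) ≤ e^{S+b}` (as `q·z ≤ e^{S+b}·p²`), cancelling the
finite non-zero factor `a²·p` (`a = 𝒵(T)`, `p = 𝒵(2T)`, `q = 𝒵(4T)`, `z = 𝒵(0)`). [folklore] -/
theorem ledger_step {a p q z : ℝ≥0∞} {S b : ℝ} (ha0 : a ≠ 0) (ha : a ≠ ⊤) (hp0 : p ≠ 0)
    (hp : p ≠ ⊤) (h1 : p * z ≤ ENNReal.ofReal (Real.exp S) * a ^ 2)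
    (h2 : q * a ^ 2 ≤ ENNReal.ofReal (Real.exp b) * p ^ 3) :
    q * z ≤ ENNReal.ofReal (Real.exp (S + b)) * p ^ 2 := by
  have hc0 : a ^ 2 * p ≠ 0 := mul_ne_zero (pow_ne_zero _ ha0) hp0
  have hc : a ^ 2 * p ≠ ⊤ := ENNReal.mul_ne_top (ENNReal.pow_ne_top ha) hp
  have hexp : ENNReal.ofReal (Real.exp (S + b)) =
      ENNReal.ofReal (Real.exp S) * ENNReal.ofReal (Real.exp b) := by
    rw [Real.exp_add, ENNReal.ofReal_mul (Real.exp_pos _).le]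
  have h := mul_le_mul' h2 h1
  refine (ENNReal.mul_le_mul_iff_left hc0 hc).mp ?_
  calc q * z * (a ^ 2 * p) = q * a ^ 2 * (p * z) := by ring
    _ ≤ ENNReal.ofReal (Real.exp b) * p ^ 3 * (ENNReal.ofReal (Real.exp S) * a ^ 2) := h
    _ = ENNReal.ofReal (Real.exp (S + b)) * p ^ 2 * (a ^ 2 * p) := by rw [hexp]; ring

/-- There is a dyadic scale `2^M t₀` beyond any given time (`t₀ > 0`). [folklore] -/
theorem exists_dyadic_ge (T : ℝ) {t₀ : ℝ} (ht₀ : 0 < t₀) : ∃ M : ℕ, T ≤ 2 ^ M * t₀ := by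
  obtain ⟨M, hM⟩ := pow_unbounded_of_one_lt (T / t₀) (one_lt_two)
  exact ⟨M, by rw [div_lt_iff₀ ht₀] at hM; exact hM.le⟩

/-! ## Composition (sorry-free): the four stubs give the crux BY NAME -/

/-- **`CorrectorClosure` from the four registered stubs** (kernel-checked glue, no `sorry` of its own):
K1 ⇒ summable dyadic majorant (`stub_dyadicTail`); with the short-time bound (`stub_shortTime`) the
ledger telescopes to `D(2^M t₀) ≤ e^{K}`, `K = C₀ + Σ b`, for EVERY `M`, uniformly in `N`; the frame
(`stub_nearMinimiserFrame`, at `ε = e^{-K}/2` and a dyadic time beyond its `T₁`) converts this into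
`Res(Θ, Ψ) ≥ e^{-K}/2` for all `δ`-near-minimisers, with `Θ₀` from `stub_groundStateExists`. [folklore] -/
theorem CorrectorClosure_of : CorrectorClosure := by
  intro hK v hv
  obtain ⟨ρ₁, hρ₁, h1⟩ := stub_shortTime v hv
  obtain ⟨ρ₂, hρ₂, h2⟩ := stub_dyadicTail hK v hv
  obtain ⟨ρ₃, hρ₃, h3⟩ := stub_groundStateExists v hv
  obtain ⟨ρ₄, hρ₄, h4⟩ := stub_nearMinimiserFrame v hv
  refine ⟨min (min ρ₁ ρ₂) (min ρ₃ ρ₄), lt_min (lt_min hρ₁ hρ₂) (lt_min hρ₃ hρ₄),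
    fun ρ hρ hρlt => ?_⟩
  have hρ1 : ρ < ρ₁ := lt_of_lt_of_le hρlt ((min_le_left _ _).trans (min_le_left _ _))
  have hρ2 : ρ < ρ₂ := lt_of_lt_of_le hρlt ((min_le_left _ _).trans (min_le_right _ _))
  have hρ3 : ρ < ρ₃ := lt_of_lt_of_le hρlt ((min_le_right _ _).trans (min_le_left _ _))
  have hρ4 : ρ < ρ₄ := lt_of_lt_of_le hρlt ((min_le_right _ _).trans (min_le_right _ _))
  obtain ⟨t₀, ht₀, C₀, h1'⟩ := h1 ρ hρ hρ1
  obtain ⟨b, hbs, hb0, h2'⟩ := h2 ρ hρ hρ2 t₀ ht₀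
  set K : ℝ := C₀ + ∑' m, b m with hK_def
  refine ⟨Real.exp (-K) / 2, by positivity, ?_⟩
  filter_upwards [h1', h2', h3 ρ hρ hρ3, h4 ρ hρ hρ4] with N hN1 hN2 hN3 hN4
  obtain ⟨Θ₀, hΘ₀⟩ := hN3
  set L : ℝ := sideLength ρ (N + 1) with hL_def
  set Z : ℝ → ℝ≥0∞ := fun t => ∫⁻ X in cellN (N + 1) L, ENNReal.ofReal (Θ₀ (Matrix.vecTail X)) *
    periodicFKSemigroup v L t (fun Y => ENNReal.ofReal (Θ₀ (Matrix.vecTail Y))) X with hZ_def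
  obtain ⟨hfin, hD0⟩ := hN1 L rfl Θ₀ hΘ₀ Z rfl
  have hinc := hN2 L rfl Θ₀ hΘ₀ Z rfl
  obtain ⟨T₁, δ, hδ, hframe⟩ := hN4 L rfl Θ₀ hΘ₀ Z rfl (Real.exp (-K) / 2) (by positivity)
  -- the telescoped ledger: `D(2^M t₀) ≤ exp (C₀ + Σ_{m<M} b m)`
  have ledger : ∀ M : ℕ, Z (2 ^ (M + 1) * t₀) * Z 0 ≤
      ENNReal.ofReal (Real.exp (C₀ + ∑ m ∈ Finset.range M, b m)) * Z (2 ^ M * t₀) ^ 2 := by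
    intro M
    induction M with
    | zero =>
      have e1 : (2 : ℝ) ^ (0 + 1) * t₀ = 2 * t₀ := by norm_num
      have e2 : (2 : ℝ) ^ 0 * t₀ = t₀ := by norm_num
      rw [e1, e2, Finset.sum_range_zero, add_zero]
      exact hD0
    | succ M ih =>
      have hT : (0 : ℝ) ≤ 2 ^ M * t₀ := by positivity
      have h2T : (0 : ℝ) ≤ 2 ^ (M + 1) * t₀ := by positivity
      have e3 : M + 1 + 1 = M + 2 := by ring
      rw [Finset.sum_range_succ, ← add_assoc, e3]
      exact ledger_step (hfin _ hT).1 (hfin _ hT).2 (hfin _ h2T).1 (hfin _ h2T).2 ih (hinc M)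
  -- a `δ`-near-minimiser `Θ` of the bath exists (`E₀^per(N, L) < ⊤`)
  obtain ⟨Θ, hΘ⟩ : ∃ Θ : PeriodicTrialState N L,
      periodicEnergy v Θ < periodicGroundStateEnergy v N L + δ :=
    iInf_lt_iff.mp (ENNReal.lt_add_right hΘ₀.energy_ne_top hδ.ne')
  refine ⟨δ, hδ, Θ, hΘ.le, fun Ψ hΨ => ?_⟩
  -- a dyadic time beyond the frame's `T₁`
  obtain ⟨M, hM⟩ := exists_dyadic_ge T₁ ht₀
  have hT : (0 : ℝ) ≤ 2 ^ M * t₀ := by positivity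
  have hA := hframe Θ hΘ.le Ψ hΨ (2 ^ M * t₀) hM
  have e4 : (2 : ℝ) * (2 ^ M * t₀) = 2 ^ (M + 1) * t₀ := by ring
  rw [e4] at hA
  -- bound the partial sum by `K`
  have hsum : C₀ + ∑ m ∈ Finset.range M, b m ≤ K := by
    rw [hK_def]
    exact add_le_add le_rfl (hbs.sum_le_tsum _ (fun m _ => hb0 m))
  have hB : Z (2 ^ (M + 1) * t₀) * Z 0 ≤ ENNReal.ofReal (Real.exp K) * Z (2 ^ M * t₀) ^ 2 :=
    (ledger M).trans (mul_le_mul'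
      (ENNReal.ofReal_le_ofReal (Real.exp_le_exp.2 hsum)) le_rfl)
  -- combine and cancel `Z(2^M t₀)²`
  set R : ℝ≥0∞ := ENNReal.ofReal ((L ^ 3)⁻¹) *
      (‖∫ X in cellN N L, conj (Θ.ψ X) * ∫ x in cell L, Ψ.ψ (Matrix.vecCons x X)‖₊ : ℝ≥0∞) ^ 2
    with hR_def
  have hsq0 : Z (2 ^ M * t₀) ^ 2 ≠ 0 := pow_ne_zero _ (hfin _ hT).1
  have hsqt : Z (2 ^ M * t₀) ^ 2 ≠ ⊤ := ENNReal.pow_ne_top (hfin _ hT).2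
  have hone : 1 * Z (2 ^ M * t₀) ^ 2 ≤
      (R + ENNReal.ofReal (Real.exp (-K) / 2)) * ENNReal.ofReal (Real.exp K) *
        Z (2 ^ M * t₀) ^ 2 := by
    calc 1 * Z (2 ^ M * t₀) ^ 2 = Z (2 ^ M * t₀) ^ 2 := one_mul _
      _ ≤ (R + ENNReal.ofReal (Real.exp (-K) / 2)) * (Z (2 ^ (M + 1) * t₀) * Z 0) := hA
      _ ≤ (R + ENNReal.ofReal (Real.exp (-K) / 2)) *
            (ENNReal.ofReal (Real.exp K) * Z (2 ^ M * t₀) ^ 2) := mul_le_mul' le_rfl hB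
      _ = (R + ENNReal.ofReal (Real.exp (-K) / 2)) * ENNReal.ofReal (Real.exp K) *
            Z (2 ^ M * t₀) ^ 2 := by ring
  have hone' : (1 : ℝ≥0∞) ≤
      (R + ENNReal.ofReal (Real.exp (-K) / 2)) * ENNReal.ofReal (Real.exp K) :=
    (ENNReal.mul_le_mul_iff_left hsq0 hsqt).mp hone
  have hinv : ENNReal.ofReal (Real.exp (-K)) * ENNReal.ofReal (Real.exp K) = 1 := by
    rw [← ENNReal.ofReal_mul (Real.exp_pos _).le, ← Real.exp_add]
    simp
  have hkey : ENNReal.ofReal (Real.exp (-K)) ≤ R + ENNReal.ofReal (Real.exp (-K) / 2) := by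
    calc ENNReal.ofReal (Real.exp (-K)) = ENNReal.ofReal (Real.exp (-K)) * 1 := (mul_one _).symm
      _ ≤ ENNReal.ofReal (Real.exp (-K)) *
            ((R + ENNReal.ofReal (Real.exp (-K) / 2)) * ENNReal.ofReal (Real.exp K)) :=
          mul_le_mul' le_rfl hone'
      _ = (R + ENNReal.ofReal (Real.exp (-K) / 2)) *
            (ENNReal.ofReal (Real.exp (-K)) * ENNReal.ofReal (Real.exp K)) := by ring
      _ = R + ENNReal.ofReal (Real.exp (-K) / 2) := by rw [hinv, mul_one]
  have hhalf : ENNReal.ofReal (Real.exp (-K)) =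
      ENNReal.ofReal (Real.exp (-K) / 2) + ENNReal.ofReal (Real.exp (-K) / 2) := by
    rw [← ENNReal.ofReal_add (by positivity) (by positivity)]
    congr 1; ring
  rw [hhalf] at hkey
  exact (ENNReal.add_le_add_iff_right ENNReal.ofReal_ne_top).mp hkey

end Summit.AtomisticToContinuum.BoseEinsteinCondensation.Cruxes.CorrectorClosure.ResidueAreaLaw

end
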